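import Summits.KontsevichZagierPeriods.KontsevichZagierPeriods.Theorems.HurwitzMicroSectorsNormalFormPrincipleL2W3DilationMove
import Summits.KontsevichZagierPeriods.KontsevichZagierPeriods.Theorems.HyperbolicBlochOffTetraSectorKernelStubAffineOrbit

/-!
# `NormalFormPrinciple` (stmt-KontsevichZagierPeriods-3869), line `SketchIdeator1` —
# leaf `stub_boxRigidity`, layer `L2W3` (level-2 weight-3 descent): the dilation (distribution) relations

Pure proof file (registered sub-goal `l2w3_relations_dilation`, lead seat c9; `--supports` the
crux). Letters on `(0,1)`: `a(u) = 1/u`, `b(u) = 1/(1−u)`, `c(u) = 1/(1+u)`; word representations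
`[x y z] = [Δ, x(t₀)y(t₁)z(t₂)]` on the decreasing open simplex `Δ = {1 > t₀ > t₁ > t₂ > 0}` are
the weight-3 iterated integrals. The DILATION `t ↦ t²` on all coordinates is ONE change of
variables of the Kontsevich–Zagier calculus (rule (2), the landed move `l2w3_dilation_move`, which
also supplies the pulled-back carrier); with the Jacobian it pulls the letters back as
`a(s²)·2s = 2a(s)`, `b(s²)·2s = b(s) − c(s)` — the DISTRIBUTION relations of level 2. Expanding by
integrand additivity (`aff_orbit_of_sub_sum_zsmul_mem_relations`):

* (rel1) `ζ(3) = ∫aab = ∫(2a)(2a)(b − c) = 4∫aab − 4∫aac`, i.e. `3[aab] − 4[aac] ∈ KZ.relations`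
  (the evaluation `∫aac = −Li₃(−1) = ¾ζ(3)` inside the calculus);
* (rel2) `∫abb = ∫(2a)(b − c)(b − c)`, i.e. `[abb] − 2[abc] − 2[acb] + 2[acc] ∈ KZ.relations`.

References: M. Kontsevich, D. Zagier, *Periods* (2001), §1.2 rules (1b), (2); A. B. Goncharov,
*Multiple polylogarithms and mixed Tate motives* (2001), §2 (distribution relations).
No definitions are introduced.
-/

noncomputable section

open MeasureTheory Set
open Literature.NumberTheory.Transcendental Literature.NumberTheory.Transcendental.KZ
open Literature.ModelTheory.ExponentialFields (IsSemialgebraic)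
open Summit.KontsevichZagierPeriods.HyperbolicBloch.OffTetraSectorKernel
  (aff_orbit_of_sub_sum_zsmul_mem_relations)

namespace Summit.KontsevichZagierPeriods.HurwitzMicroSectors.NormalFormPrinciple.PiBox.M3

/-- Coordinate facts on the decreasing open simplex. [folklore] -/
theorem l2v_simplex_facts {t : Fin 3 → ℝ}
    (ht : t ∈ {t : Fin 3 → ℝ | 0 < t 2 ∧ t 2 < t 1 ∧ t 1 < t 0 ∧ t 0 < 1}) :
    0 < t 0 ∧ t 0 < 1 ∧ 0 < t 1 ∧ t 1 < 1 ∧ 0 < t 2 ∧ t 2 < 1 := by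
  obtain ⟨h2, h21, h10, h0⟩ := ht
  exact ⟨by linarith, h0, by linarith, by linarith, h2, by linarith⟩

/-- The dilation pull-backs of the letters: `a(s²)·2s = 2a(s)` and `b(s²)·2s = b(s) − c(s)` on
`(0,1)` (the level-2 distribution relations of the letters). [folklore] -/
theorem l2v_dilation_letter_pulls {u : ℝ} (h0 : 0 < u) (h1 : u < 1) :
    1 / u ^ 2 * (2 * u) = 2 * (1 / u) ∧
    1 / (1 - u ^ 2) * (2 * u) = 1 / (1 - u) - 1 / (1 + u) := by
  have hu : u ≠ 0 := h0.ne'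
  have hp : (1:ℝ) + u ≠ 0 := by linarith
  have hm : (1:ℝ) - u ≠ 0 := by linarith
  have hq : (1:ℝ) - u ^ 2 ≠ 0 := by
    have : (1:ℝ) - u ^ 2 = (1 - u) * (1 + u) := by ring
    rw [this]; exact mul_ne_zero hm hp
  refine ⟨?_, ?_⟩
  · field_simp
  · field_simp; ring

/-- **Stub (`l2w3_relations_dilation`; registered sub-goal of stmt-KontsevichZagierPeriods-3869,
line `SketchIdeator1`, layer `L2W3`).** The two dilation (distribution) relations among weight-3
level-2 word representations on the simplex: `3[aab] − 4[aac] ∈ KZ.relations` and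
`[abb] − 2[abc] − 2[acb] + 2[acc] ∈ KZ.relations`, for arbitrary carriers with the displayed
integrands; each is ONE dilation move (rule 2) plus integrand additivity (rule 1b).
[cite: KontsevichZagier2001, §1.2 rules (1), (2)] -/
theorem l2w3_relations_dilation :
    (∀ (AAB : IntegralRep 3), AAB.domain = {t | 0 < t 2 ∧ t 2 < t 1 ∧ t 1 < t 0 ∧ t 0 < 1} →
        (AAB.integrand = fun t => 1 / t 0 * 1 / t 1 * (1 / (1 - t 2))) →
      ∀ (AAC : IntegralRep 3), AAC.domain = {t | 0 < t 2 ∧ t 2 < t 1 ∧ t 1 < t 0 ∧ t 0 < 1} →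
        (AAC.integrand = fun t => 1 / t 0 * 1 / t 1 * (1 / (1 + t 2))) →
        (3:ℤ) • of AAB - (4:ℤ) • of AAC ∈ relations) ∧
    (∀ (ABB : IntegralRep 3), ABB.domain = {t | 0 < t 2 ∧ t 2 < t 1 ∧ t 1 < t 0 ∧ t 0 < 1} →
        (ABB.integrand = fun t => 1 / t 0 * (1 / (1 - t 1)) * (1 / (1 - t 2))) →
      ∀ (ABC : IntegralRep 3), ABC.domain = {t | 0 < t 2 ∧ t 2 < t 1 ∧ t 1 < t 0 ∧ t 0 < 1} →
        (ABC.integrand = fun t => 1 / t 0 * (1 / (1 - t 1)) * (1 / (1 + t 2))) →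
      ∀ (ACB : IntegralRep 3), ACB.domain = {t | 0 < t 2 ∧ t 2 < t 1 ∧ t 1 < t 0 ∧ t 0 < 1} →
        (ACB.integrand = fun t => 1 / t 0 * (1 / (1 + t 1)) * (1 / (1 - t 2))) →
      ∀ (ACC : IntegralRep 3), ACC.domain = {t | 0 < t 2 ∧ t 2 < t 1 ∧ t 1 < t 0 ∧ t 0 < 1} →
        (ACC.integrand = fun t => 1 / t 0 * (1 / (1 + t 1)) * (1 / (1 + t 2))) →
        of ABB - (2:ℤ) • of ABC - (2:ℤ) • of ACB + (2:ℤ) • of ACC ∈ relations) := by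
  refine ⟨?_, ?_⟩
  · -- (rel1) the dilation move on the word `a a b`
    intro AAB hAABd hAABi AAC hAACd hAACi
    have hTi : EqOn AAB.integrand (fun t => (fun u : ℝ => 1 / u) (t 0) *
        (fun u : ℝ => 1 / u) (t 1) * (fun u : ℝ => 1 / (1 - u)) (t 2)) AAB.domain := fun t _ => by
      simp only [hAABi]
      ring
    obtain ⟨hmove, N, hNd, hNi⟩ := l2w3_dilation_move (fun u => 1 / u) (fun u => 1 / u)
      (fun u => 1 / (1 - u)) AAB hAABd hTi
    have m1 : of N - of AAB ∈ relations := hmove N hNd (hNi ▸ fun _ _ => rfl)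
    -- rule (1b) on `Δ`: `[N] = 4[AAB] − 4[AAC]`
    have m2 : of N - ((4:ℤ) • of AAB + (-4:ℤ) • of AAC) ∈ relations := by
      have h := aff_orbit_of_sub_sum_zsmul_mem_relations (Finset.univ : Finset (Fin 2))
        ![AAB, AAC] ![4, -4] N (fun i _ => by
          fin_cases i
          · exact hAABd.trans hNd.symm
          · exact hAACd.trans hNd.symm) fun t ht => ?_
      · simpa [Fin.sum_univ_two] using h
      have hf := l2v_simplex_facts (hNd ▸ ht)
      rw [hNi]
      simp only [Fin.sum_univ_two, Matrix.cons_val_zero, Matrix.cons_val_one, hAABi, hAACi]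
      rw [(l2v_dilation_letter_pulls hf.1 hf.2.1).1, (l2v_dilation_letter_pulls hf.2.2.1 hf.2.2.2.1).1,
        (l2v_dilation_letter_pulls hf.2.2.2.2.1 hf.2.2.2.2.2).2]
      push_cast
      ring
    have e : (3:ℤ) • of AAB - (4:ℤ) • of AAC =
        (of N - of AAB) - (of N - ((4:ℤ) • of AAB + (-4:ℤ) • of AAC)) := by
      simp only [neg_smul]; abel
    rw [e]
    exact relations.sub_mem m1 m2
  · -- (rel2) the dilation move on the word `a b b`
    intro ABB hABBd hABBi ABC hABCd hABCi ACB hACBd hACBi ACC hACCd hACCi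
    have hTi : EqOn ABB.integrand (fun t => (fun u : ℝ => 1 / u) (t 0) *
        (fun u : ℝ => 1 / (1 - u)) (t 1) * (fun u : ℝ => 1 / (1 - u)) (t 2)) ABB.domain :=
      fun t _ => by simp only [hABBi]
    obtain ⟨hmove, N, hNd, hNi⟩ := l2w3_dilation_move (fun u => 1 / u) (fun u => 1 / (1 - u))
      (fun u => 1 / (1 - u)) ABB hABBd hTi
    have m1 : of N - of ABB ∈ relations := hmove N hNd (hNi ▸ fun _ _ => rfl)
    -- rule (1b) on `Δ`: `[N] = 2[ABB] − 2[ABC] − 2[ACB] + 2[ACC]`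
    have m2 : of N - ((2:ℤ) • of ABB + (-2:ℤ) • of ABC + (-2:ℤ) • of ACB + (2:ℤ) • of ACC) ∈
        relations := by
      have h := aff_orbit_of_sub_sum_zsmul_mem_relations (Finset.univ : Finset (Fin 4))
        ![ABB, ABC, ACB, ACC] ![2, -2, -2, 2] N (fun i _ => by
          fin_cases i
          · exact hABBd.trans hNd.symm
          · exact hABCd.trans hNd.symm
          · exact hACBd.trans hNd.symm
          · exact hACCd.trans hNd.symm) fun t ht => ?_
      · simpa [Fin.sum_univ_four, add_assoc] using h
      have hf := l2v_simplex_facts (hNd ▸ ht)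
      rw [hNi]
      simp only [Fin.sum_univ_four, Matrix.cons_val_zero, Matrix.cons_val_one, Matrix.cons_val_two,
        Matrix.cons_val_three, Matrix.head_cons, Matrix.tail_cons, hABBi, hABCi, hACBi, hACCi]
      rw [(l2v_dilation_letter_pulls hf.1 hf.2.1).1, (l2v_dilation_letter_pulls hf.2.2.1 hf.2.2.2.1).2,
        (l2v_dilation_letter_pulls hf.2.2.2.2.1 hf.2.2.2.2.2).2]
      push_cast
      ring
    have e : of ABB - (2:ℤ) • of ABC - (2:ℤ) • of ACB + (2:ℤ) • of ACC =
        (of N - of ABB) - (of N - ((2:ℤ) • of ABB + (-2:ℤ) • of ABC + (-2:ℤ) • of ACB + (2:ℤ) • of ACC))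
          + ((2:ℤ) • of ABB - of ABB - of ABB) := by
      simp only [neg_smul]; abel
    have e2 : (2:ℤ) • of ABB - of ABB - of ABB = 0 := by
      rw [two_zsmul]; abel
    rw [e, e2, add_zero]
    exact relations.sub_mem m1 m2

end Summit.KontsevichZagierPeriods.HurwitzMicroSectors.NormalFormPrinciple.PiBox.M3
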